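import Summits.NavierStokesRegularity.NavierStokesRegularity.Theorems.EulerZoomLiouvillePowerGaugeEulerLiouvilleEnergySaturationCutoff

/-!
# Energy saturation on rung C1 of the crux `EulerZoomLiouville.PowerGaugeEulerLiouville`, II:
# the exact SCALE IDENTITY for the normalised profile energy
# (crux = stmt-NavierStokesRegularity-19832, route №10 `EulerZoomLiouville`, line `birth`)

Seat `ns-ezl-19832-w2` (stub-worker under the crux lead `ns-ezl-19832-p1`), cell ns-regularity-ideate.

Let `(V, P)` be the profile of an exactly self-similar member of Seregin's power-gauged ancient
Euler class (`u(t,x) = (−t)^{γ−1} V((−t)^{−γ} x)`, `γ = 1/(2+ρ)`).  The lead's Euler-identity lever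
(`ProfileEnergy.profile_local_energy_equality`, file `…ProfileEnergyEquality`) is the PROFILE LOCAL
ENERGY EQUALITY: for every test function `σ`,

  `(2 − 5γ) ∫ σ|V|² = ∫ (|V|² + 2P) ⟪V, ∇σ⟫ + γ ∫ |V|² ⟪y, ∇σ⟫`.                       (EE_σ)

This file turns (EE_σ), applied to the RESCALED cut-offs `σ_L(y) = σ(L⁻¹ y)`, into an exact
ordinary differential equation in the scale `L` for the normalised, smoothly cut-off energy

  `N_σ(L) = L^{2ρ−1} ∫ σ(L⁻¹ y) |V(y)|² dy`

(`L^{2ρ−1} = L^{−(N−2α)}` is the Chae–Shvydkoy / Bronzi–Shvydkoy normalisation, `N = 3`,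
`α = 1 + ρ`; the `A`-gauge of the class says precisely that `N_σ` is bounded):

* `hasDerivAt_normEnergy_of_energyEquality` — **the scale ODE**
  `N_σ'(L) = (2+ρ) · L^{2ρ−2} · F_σ(L)`, `F_σ(L) = ∫ (|V|² + 2P) ⟪V, ∇σ_L⟫` the Bernoulli flux
  through the cut-off at scale `L` (this is (EE_{σ_L}) and the elementary identity
  `d/dL [L^{2ρ−1} σ(L⁻¹y)] = (2+ρ) L^{2ρ−2} [(2−5γ) σ_L(y) − γ ⟪y, ∇σ_L(y)⟫]`, `γ = 1/(2+ρ)`);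
* `normEnergy_sub_eq_integral_flux` — **the integrated scale identity**
  `N_σ(L₂) − N_σ(L₁) = (2+ρ) ∫_{L₁}^{L₂} r^{2ρ−2} F_σ(r) dr` (`0 < L₁ ≤ L₂`),
  the EQUALITY form of Chae–Shvydkoy's basic energy balance (arXiv:1201.6009, (2.12)), which the
  local energy INEQUALITY of the member gives only as `≤` (no anomalous dissipation is exactly the
  content of the Euler identity here).

The sequel files bound the dyadic blocks `∫_L^{2L} r^{2ρ−2}|F_σ|` by the three gauges and conclude:
the limit `N_∞ = lim_{L→∞} L^{2ρ−1}∫_{B_L}|V|²` exists for every member, and a SUB-EXTREMAL member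
(`N_∞ = 0`) is trivial — Bronzi–Shvydkoy's dichotomy (arXiv:1310.8611 Thm 1.1, classical `C³`
profiles) in Seregin's weak class.  WHAT THIS IS NOT: not NS regularity, not the crux, not rung C1 —
real-analysis bookkeeping on top of the lead's identity; `--supports` stmt-19832. [folklore]
-/

noncomputable section

set_option linter.dupNamespace false

open MeasureTheory Set Filter Topology Metric Function TopologicalSpace
open scoped ENNReal NNReal RealInnerProductSpace ContDiff

namespace Summit.NavierStokesRegularity.NavierStokesRegularity.Theorems.PowerGaugeEulerLiouville

open Literature.Analysis Literature.Analysis.FunctionSpaces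

namespace EnergySaturation

/-! ## The scale ODE and the integrated scale identity -/

section ScaleIdentity

variable {ρ : ℝ} {σ : EuclideanSpace ℝ (Fin 3) → ℝ}
  {V : EuclideanSpace ℝ (Fin 3) → EuclideanSpace ℝ (Fin 3)} {P : EuclideanSpace ℝ (Fin 3) → ℝ}

/-- **The scale ODE for the normalised profile energy.**  Let `σ` be a test function, `V ∈ L²_loc`,
and suppose the profile local energy EQUALITY (the conclusion of
`ProfileEnergy.profile_local_energy_equality`, exponent `γ = 1/(2+ρ)`) holds for the rescaled
cut-offs `σ_L = σ(L⁻¹·)`.  Then the normalised cut-off energy `N_σ(L) = L^{2ρ−1}∫σ(L⁻¹y)|V|²`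
satisfies, at every `L > 0`,
`N_σ'(L) = (2+ρ) · L^{2ρ−2} · F_σ(L)`, `F_σ(L) = ∫ (|V|²+2P)⟪V, ∇σ_L⟫`
(since `(2−5γ) = γ(2ρ−1)` and `γ⟪y,∇σ_L(y)⟫ = γ Dσ(L⁻¹y)[L⁻¹y]`).  The local energy inequality
alone would give only `N_σ' ≤ (2+ρ)L^{2ρ−2}F_σ`. [folklore; cf. ChaeShvydkoy2013 §2.2 (2.12)] -/
theorem hasDerivAt_normEnergy_of_energyEquality (hρ : 0 < ρ)
    (hσ : IsTestFunctionOn (⊤ : Opens (EuclideanSpace ℝ (Fin 3))) σ)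
    (hVm : AEStronglyMeasurable V volume)
    (hV2 : LocallyIntegrable (fun y => ‖V y‖ ^ 2) volume)
    {L : ℝ} (hL : 0 < L)
    (hEE : (2 - 5 * (1 / (2 + ρ))) * ∫ x, σ (L⁻¹ • x) * ‖V x‖ ^ 2 =
      (∫ x, (‖V x‖ ^ 2 + 2 * P x) * ⟪V x, gradient (fun z => σ (L⁻¹ • z)) x⟫) +
        (1 / (2 + ρ)) * ∫ x, ‖V x‖ ^ 2 * ⟪x, gradient (fun z => σ (L⁻¹ • z)) x⟫) :
    HasDerivAt (fun L : ℝ => L ^ (2 * ρ - 1) * ∫ y, σ (L⁻¹ • y) * ‖V y‖ ^ 2)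
      ((2 + ρ) * L ^ (2 * ρ - 2) *
        ∫ x, (‖V x‖ ^ 2 + 2 * P x) * ⟪V x, gradient (fun z => σ (L⁻¹ • z)) x⟫) L := by
  have h2ρ : 0 < 2 + ρ := by linarith
  have hσ1 : ContDiff ℝ 1 σ := hσ.contDiff.of_le (by norm_cast)
  have hσd : Differentiable ℝ σ := hσ1.differentiable one_ne_zero
  obtain ⟨hI'int, hI⟩ := hasDerivAt_cutoffEnergy hσ1 hσ.hasCompactSupport hVm hV2 hL
  -- the derivative of the product `L^{2ρ−1} · I(L)`
  have hpow : HasDerivAt (fun L : ℝ => L ^ (2 * ρ - 1)) ((2 * ρ - 1) * L ^ (2 * ρ - 1 - 1)) L :=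
    Real.hasDerivAt_rpow_const (Or.inl hL.ne')
  have hprod : HasDerivAt (fun L : ℝ => L ^ (2 * ρ - 1) * ∫ y, σ (L⁻¹ • y) * ‖V y‖ ^ 2)
      ((2 * ρ - 1) * L ^ (2 * ρ - 1 - 1) * (∫ y, σ (L⁻¹ • y) * ‖V y‖ ^ 2) +
        L ^ (2 * ρ - 1) * ∫ y, (-(L ^ 2)⁻¹ * fderiv ℝ σ (L⁻¹ • y) y) * ‖V y‖ ^ 2) L :=
    hpow.mul hI
  refine hprod.congr_deriv ?_
  -- rewrite the Euler term of (EE) through the scale derivative of the cut-off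
  have heuler : ∫ x, ‖V x‖ ^ 2 * ⟪x, gradient (fun z => σ (L⁻¹ • z)) x⟫ =
      -L * ∫ y, (-(L ^ 2)⁻¹ * fderiv ℝ σ (L⁻¹ • y) y) * ‖V y‖ ^ 2 := by
    rw [← integral_const_mul]
    refine integral_congr_ae (Eventually.of_forall fun y => ?_)
    show ‖V y‖ ^ 2 * ⟪y, gradient (fun z => σ (L⁻¹ • z)) y⟫ =
      -L * (-(L ^ 2)⁻¹ * fderiv ℝ σ (L⁻¹ • y) y * ‖V y‖ ^ 2)
    rw [inner_self_gradient_comp_inv_smul hσd, map_smul, smul_eq_mul]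
    field_simp
  -- solve (EE) for the flux and substitute
  have hflux : (∫ x, (‖V x‖ ^ 2 + 2 * P x) * ⟪V x, gradient (fun z => σ (L⁻¹ • z)) x⟫) =
      (2 - 5 * (1 / (2 + ρ))) * (∫ x, σ (L⁻¹ • x) * ‖V x‖ ^ 2) -
        (1 / (2 + ρ)) * (-L * ∫ y, (-(L ^ 2)⁻¹ * fderiv ℝ σ (L⁻¹ • y) y) * ‖V y‖ ^ 2) := by
    rw [← heuler]; linarith
  rw [hflux]
  have e1 : L ^ (2 * ρ - 1 - 1) = L ^ (2 * ρ - 2) := by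
    congr 1; ring
  have e2 : L ^ (2 * ρ - 1) = L ^ (2 * ρ - 2) * L := by
    rw [show 2 * ρ - 1 = (2 * ρ - 2) + 1 by ring, Real.rpow_add hL, Real.rpow_one]
  rw [e1, e2]
  field_simp
  ring

/-- **The integrated scale identity (Chae–Shvydkoy's energy balance with EQUALITY).**  Under the
hypotheses of `hasDerivAt_normEnergy_of_energyEquality` at every scale `L > 0`, for
`0 < L₁ ≤ L₂`:
`L₂^{2ρ−1}∫σ(L₂⁻¹y)|V|² − L₁^{2ρ−1}∫σ(L₁⁻¹y)|V|² = (2+ρ) ∫_{L₁}^{L₂} r^{2ρ−2} F_σ(r) dr`,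
`F_σ(r) = ∫ (|V|²+2P)⟪V, ∇σ_r⟫`.  (Chae–Shvydkoy 2013 (2.12) is the inequality `≤ C∫(|v|³+|q||v|)/|y|^{N+1−2α}`
obtained from the member's local energy inequality; the equality needs the Euler identity.)
[folklore; cf. ChaeShvydkoy2013 §2.2 (2.12)] -/
theorem normEnergy_sub_eq_integral_flux (hρ : 0 < ρ)
    (hσ : IsTestFunctionOn (⊤ : Opens (EuclideanSpace ℝ (Fin 3))) σ)
    (hVm : AEStronglyMeasurable V volume)
    (hV2 : LocallyIntegrable (fun y => ‖V y‖ ^ 2) volume)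
    (hEE : ∀ L : ℝ, 0 < L → (2 - 5 * (1 / (2 + ρ))) * ∫ x, σ (L⁻¹ • x) * ‖V x‖ ^ 2 =
      (∫ x, (‖V x‖ ^ 2 + 2 * P x) * ⟪V x, gradient (fun z => σ (L⁻¹ • z)) x⟫) +
        (1 / (2 + ρ)) * ∫ x, ‖V x‖ ^ 2 * ⟪x, gradient (fun z => σ (L⁻¹ • z)) x⟫)
    {L₁ L₂ : ℝ} (hL₁ : 0 < L₁) (h12 : L₁ ≤ L₂) :
    L₂ ^ (2 * ρ - 1) * (∫ y, σ (L₂⁻¹ • y) * ‖V y‖ ^ 2) -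
        L₁ ^ (2 * ρ - 1) * (∫ y, σ (L₁⁻¹ • y) * ‖V y‖ ^ 2) =
      ∫ r in L₁..L₂, (2 + ρ) * r ^ (2 * ρ - 2) *
        ∫ x, (‖V x‖ ^ 2 + 2 * P x) * ⟪V x, gradient (fun z => σ (r⁻¹ • z)) x⟫ := by
  have h2ρ : 0 < 2 + ρ := by linarith
  have hσ1 : ContDiff ℝ 1 σ := hσ.contDiff.of_le (by norm_cast)
  have hσd : Differentiable ℝ σ := hσ1.differentiable one_ne_zero
  -- the derivative on `[L₁, L₂]`
  have hderiv : ∀ r ∈ uIcc L₁ L₂, HasDerivAt (fun L : ℝ => L ^ (2 * ρ - 1) * ∫ y, σ (L⁻¹ • y) * ‖V y‖ ^ 2)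
      ((2 + ρ) * r ^ (2 * ρ - 2) *
        ∫ x, (‖V x‖ ^ 2 + 2 * P x) * ⟪V x, gradient (fun z => σ (r⁻¹ • z)) x⟫) r := by
    intro r hr
    rw [uIcc_of_le h12] at hr
    have hr0 : 0 < r := lt_of_lt_of_le hL₁ hr.1
    exact hasDerivAt_normEnergy_of_energyEquality hρ hσ hVm hV2 hr0 (hEE r hr0)
  -- the derivative is continuous on `[L₁, L₂]`, in the form `(2ρ−1)L^{2ρ−2} I(L) + L^{2ρ−1} I'(L)`
  have hcontI : ContinuousOn (fun L : ℝ => ∫ y, σ (L⁻¹ • y) * ‖V y‖ ^ 2) (Icc L₁ L₂) :=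
    fun r hr => (hasDerivAt_cutoffEnergy hσ1 hσ.hasCompactSupport hVm hV2
      (lt_of_lt_of_le hL₁ hr.1)).2.continuousAt.continuousWithinAt
  have hcontI' : ContinuousOn
      (fun L : ℝ => ∫ y, (-(L ^ 2)⁻¹ * fderiv ℝ σ (L⁻¹ • y) y) * ‖V y‖ ^ 2) (Icc L₁ L₂) :=
    fun r hr => (continuousAt_cutoffEnergyDeriv hσ1 hσ.hasCompactSupport hVm hV2
      (lt_of_lt_of_le hL₁ hr.1)).continuousWithinAt
  have hpow1 : ContinuousOn (fun L : ℝ => L ^ (2 * ρ - 2)) (Icc L₁ L₂) := fun r hr =>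
    (Real.continuousAt_rpow_const _ _ (Or.inl (lt_of_lt_of_le hL₁ hr.1).ne')).continuousWithinAt
  have hpow2 : ContinuousOn (fun L : ℝ => L ^ (2 * ρ - 1)) (Icc L₁ L₂) := fun r hr =>
    (Real.continuousAt_rpow_const _ _ (Or.inl (lt_of_lt_of_le hL₁ hr.1).ne')).continuousWithinAt
  have hcont : ContinuousOn (fun r : ℝ => (2 + ρ) * r ^ (2 * ρ - 2) *
      ∫ x, (‖V x‖ ^ 2 + 2 * P x) * ⟪V x, gradient (fun z => σ (r⁻¹ • z)) x⟫) (Icc L₁ L₂) := by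
    have hexpr : ContinuousOn (fun L : ℝ => (2 * ρ - 1) * L ^ (2 * ρ - 2) * (∫ y, σ (L⁻¹ • y) * ‖V y‖ ^ 2)
        + L ^ (2 * ρ - 1) * ∫ y, (-(L ^ 2)⁻¹ * fderiv ℝ σ (L⁻¹ • y) y) * ‖V y‖ ^ 2) (Icc L₁ L₂) :=
      ((continuousOn_const.mul hpow1).mul hcontI).add (hpow2.mul hcontI')
    refine hexpr.congr fun r hr => ?_
    have hr0 : 0 < r := lt_of_lt_of_le hL₁ hr.1
    -- both sides are the derivative of `N_σ` at `r`
    have hd1 := hasDerivAt_normEnergy_of_energyEquality hρ hσ hVm hV2 hr0 (hEE r hr0)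
    have hpow : HasDerivAt (fun L : ℝ => L ^ (2 * ρ - 1)) ((2 * ρ - 1) * r ^ (2 * ρ - 1 - 1)) r :=
      Real.hasDerivAt_rpow_const (Or.inl hr0.ne')
    have hd2 := hpow.mul (hasDerivAt_cutoffEnergy hσ1 hσ.hasCompactSupport hVm hV2 hr0).2
    have := hd1.unique hd2
    rw [this, show (2 * ρ - 1 - 1) = 2 * ρ - 2 by ring]
  rw [intervalIntegral.integral_eq_sub_of_hasDerivAt hderiv (hcont.intervalIntegrable_of_Icc h12)]

end ScaleIdentity

end EnergySaturation

end Summit.NavierStokesRegularity.NavierStokesRegularity.Theorems.PowerGaugeEulerLiouville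

end
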